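import Mathlib
import HarnessLib
import Summits.NavierStokesRegularity.NavierStokesRegularity.Theorems.PoloidalWindowRigidity.Negative.TriWaveProfile
import Summits.NavierStokesRegularity.NavierStokesRegularity.Theorems.PoloidalWindowRigidity.Negative.GaugeClauseDrift

/-!
# Crux `PoloidalWindowRigidity` (K2, stmt-NavierStokesRegularity-19708) — negative side:
# the no-source-gauge clause holds for the three-wave profile

Negative-side support (refuter seat ns-regularity-refuter1 gen 2; D-0081 §C), sequel of `…Negative.TriWaveProfile`,
reusing the generic pieces of `…Negative.GaugeClauseDrift` (`eq_of_fderiv_horizontal_eq_zero`,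
`hasDerivAt_cellAmp_neg_one`, `differentiable_slice_of_contDiffOn_slab`).

`ψ₀ = 2v₂` is a stream function of the horizontal vorticity of `v = triProfile`; every `C²` stream function is
`ψ₀ + g(t,x₂)`.  At `t = −1` compare `P = (π/2)e₀` and `Q = P + 2π e₀`: `T` and hence `ψ(−1,·)` are `2π e₀`-periodic,
so the advection and Laplacian terms of the source agree (translation invariance, `laplacian_comp_add_const`), the
gauge part contributes equally (same height), but the parabolic SCALING breaks the periodicity of `∂ₜψ₀`:
`∂ₜψ₀(−1, l e₀) = 2l sin l − 2cos l` is `π` at `P` and `5π` at `Q`.  Hence `noSourceGauge_triProfile`: for EVERY `C²`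
stream function and every `src : ℝ → ℝ` some source value differs from `src t` (clause (16) of S2⁗, even without its
slope hypotheses).

WHAT THIS IS NOT: not a claim about Navier–Stokes — kinematics of an explicit profile. [folklore]
-/

noncomputable section

-- the summit and its single sub-problem share the name (CONVENTIONS §1), as in every Theorems file
set_option linter.dupNamespace false

namespace Summit.NavierStokesRegularity.NavierStokesRegularity.Theorems.PoloidalWindowRigidity.Negative

open MeasureTheory Set Function Filter Topology Metric
open scoped RealInnerProductSpace InnerProductSpace ENNReal NNReal Laplacian
open Literature.Analysis Literature.Analysis.FluidPDE


/-! ## The no-source-gauge clause for the three-wave profile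

`ψ₀ = 2v₂` is a stream function of the horizontal vorticity; every `C²` stream function is `ψ₀ + g(t, x₂)`.  At
`t = −1` compare `P = (π/2)e₀` and `Q = P + 2π e₀`: `T` and `ψ(−1,·)` are `2π e₀`-periodic, so the advection and
Laplacian terms agree (translation invariance), the gauge part `g` contributes equally (same height), but the
parabolic SCALING of the profile breaks the periodicity of `∂ₜψ₀`: `∂ₜψ₀(−1,P) = π`, `∂ₜψ₀(−1,Q) = 5π`. -/

/-- Derivative of `x ↦ 2 v₂(t,x)`. [folklore] -/
theorem hasFDerivAt_two_mul_triProfile_two (t : ℝ) (y : EuclideanSpace ℝ (Fin 3)) :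
    HasFDerivAt (fun x : EuclideanSpace ℝ (Fin 3) => 2 * triProfile t x 2)
      ((2 : ℝ) • ((EuclideanSpace.proj (2 : Fin 3) : EuclideanSpace ℝ (Fin 3) →L[ℝ] ℝ).comp (fderiv ℝ (triProfile t)
          y))) y := by
  have hd : HasFDerivAt (triProfile t) (fderiv ℝ (triProfile t) y) y :=
    (hasFDerivAt_triProfile t y).differentiableAt.hasFDerivAt
  exact ((EuclideanSpace.proj (2 : Fin 3) : EuclideanSpace ℝ (Fin 3) →L[ℝ] ℝ).hasFDerivAt.comp y hd).const_mul (2 : ℝ)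

/-- `D(2v₂)(t,y) w = 2 (−t)^{-1} DT₂(A_t y) w`. [folklore] -/
theorem fderiv_two_mul_triProfile_two (t : ℝ) (y w : EuclideanSpace ℝ (Fin 3)) :
    fderiv ℝ (fun x : EuclideanSpace ℝ (Fin 3) => 2 * triProfile t x 2) y w = 2 * (cellAmp t ^ 2 * triDeriv
        (driftShift t y) w 2) := by
  rw [(hasFDerivAt_two_mul_triProfile_two t y).fderiv]
  simp [fderiv_triProfile_apply]

/-- `ψ₀ = 2v₂` is a stream function of the horizontal vorticity: `curl v 0 = ∂₁ψ₀`, `curl v 1 = −∂₀ψ₀`. [folklore] -/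
theorem stream_two_mul_triProfile_two (t : ℝ) (y : EuclideanSpace ℝ (Fin 3)) :
    curl (triProfile t) y 0 = fderiv ℝ (fun x : EuclideanSpace ℝ (Fin 3) => 2 * triProfile t x 2) y
        (EuclideanSpace.single (1 : Fin 3) (1 : ℝ)) ∧
      curl (triProfile t) y 1 = -fderiv ℝ (fun x : EuclideanSpace ℝ (Fin 3) => 2 * triProfile t x 2) y
          (EuclideanSpace.single (0 : Fin 3) (1 : ℝ)) := by
  rw [fderiv_two_mul_triProfile_two, fderiv_two_mul_triProfile_two, curl_triProfile_apply_zero,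
    curl_triProfile_apply_one, triDeriv_apply_two, triDeriv_apply_two]
  constructor
  · simp; ring
  · simp; ring

/-- Every `C²` stream function of the horizontal vorticity of `v` differs from `ψ₀ = 2v₂` by a function of
`(t, x₂)` only. [folklore] -/
theorem stream_sub_two_mul_triProfile_two_dependsOnHeight {ψ : ℝ → EuclideanSpace ℝ (Fin 3) → ℝ}
    (hψ : ContDiffOn ℝ 2 (uncurry ψ) (Iio (0 : ℝ) ×ˢ univ))
    (hstr : ∀ t < 0, ∀ y, curl (triProfile t) y 0 = fderiv ℝ (ψ t) y (EuclideanSpace.single (1 : Fin 3) (1 : ℝ)) ∧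
      curl (triProfile t) y 1 = -fderiv ℝ (ψ t) y (EuclideanSpace.single (0 : Fin 3) (1 : ℝ)))
    {t : ℝ} (ht : t < 0) {x x' : EuclideanSpace ℝ (Fin 3)} (hx : x 2 = x' 2) :
    ψ t x - 2 * triProfile t x 2 = ψ t x' - 2 * triProfile t x' 2 := by
  have hd1 : Differentiable ℝ (ψ t) := differentiable_slice_of_contDiffOn_slab hψ ht
  have hd2 : Differentiable ℝ (fun x : EuclideanSpace ℝ (Fin 3) => 2 * triProfile t x 2) :=
    fun y => (hasFDerivAt_two_mul_triProfile_two t y).differentiableAt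
  have hsub : ∀ y w, fderiv ℝ (fun x => ψ t x - 2 * triProfile t x 2) y w =
      fderiv ℝ (ψ t) y w - fderiv ℝ (fun x : EuclideanSpace ℝ (Fin 3) => 2 * triProfile t x 2) y w := by
    intro y w
    have h : HasFDerivAt (fun x => ψ t x - 2 * triProfile t x 2)
        (fderiv ℝ (ψ t) y - fderiv ℝ (fun x : EuclideanSpace ℝ (Fin 3) => 2 * triProfile t x 2) y) y :=
      (hd1 y).hasFDerivAt.sub (hd2 y).hasFDerivAt
    rw [h.fderiv, sub_apply]
  refine eq_of_fderiv_horizontal_eq_zero (φ := fun x => ψ t x - 2 * triProfile t x 2) (hd1.sub hd2)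
    (fun y => ?_) (fun y => ?_) hx
  · rw [hsub]
    linarith [(hstr t ht y).2, (stream_two_mul_triProfile_two t y).2]
  · rw [hsub]
    linarith [(hstr t ht y).1, (stream_two_mul_triProfile_two t y).1]

/-- `ψ₀(τ, l e₀) = −4 c_τ cos(c_τ l)` (`c_τ = (−τ)^{-1/2}`). [folklore] -/
theorem two_mul_triProfile_two_axisPoint (τ l : ℝ) :
    2 * triProfile τ (l • (EuclideanSpace.single (0 : Fin 3) (1 : ℝ))) 2 = -4 * (cellAmp τ * Real.cos (cellAmp τ *
        l)) := by
  simp [triProfile, triField_apply_two, driftShift_apply_zero, driftShift_apply_one, driftShift_apply_two]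
  ring

/-- `∂ₜψ₀(−1, l e₀) = 2 l sin l − 2 cos l`. [folklore] -/
theorem hasDerivAt_two_mul_triProfile_two_axisPoint (l : ℝ) :
    HasDerivAt (fun τ : ℝ => 2 * triProfile τ (l • (EuclideanSpace.single (0 : Fin 3) (1 : ℝ))) 2) (2 * l * Real.sin
        l - 2 * Real.cos l) (-1) := by
  have f : (fun τ : ℝ => 2 * triProfile τ (l • (EuclideanSpace.single (0 : Fin 3) (1 : ℝ))) 2) =
      fun τ => -4 * (cellAmp τ * Real.cos (cellAmp τ * l)) := by
    funext τ
    exact two_mul_triProfile_two_axisPoint τ l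
  have hc := hasDerivAt_cellAmp_neg_one
  have hC := (hc.mul_const l).cos
  rw [f]
  refine ((hc.mul hC).const_mul (-4)).congr_deriv ?_
  simp [cellAmp]
  ring

/-- Translation invariance of the Laplacian: `Δ(f(· + a))(x) = (Δf)(x + a)`. [folklore] -/
theorem laplacian_comp_add_const {F : Type*} [NormedAddCommGroup F] [NormedSpace ℝ F] (f : EuclideanSpace ℝ (Fin 3) →
    F) (a x : EuclideanSpace ℝ (Fin 3)) :
    (Δ (fun y => f (y + a))) x = (Δ f) (x + a) := by
  rw [InnerProductSpace.laplacian_eq_iteratedFDeriv_stdOrthonormalBasis,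
    InnerProductSpace.laplacian_eq_iteratedFDeriv_stdOrthonormalBasis]
  simp only [iteratedFDeriv_comp_add_right]

/-- `T` is `2π e₀`-periodic. [folklore] -/
theorem triField_add_two_pi_single_zero (y : EuclideanSpace ℝ (Fin 3)) : triField (y + (2 * Real.pi) •
    (EuclideanSpace.single (0 : Fin 3) (1 : ℝ))) = triField y := by
  have h0 : (y + (2 * Real.pi) • (EuclideanSpace.single (0 : Fin 3) (1 : ℝ)) : EuclideanSpace ℝ (Fin 3)) 0 = y 0 + 2
      * Real.pi := by simp
  have h1 : (y + (2 * Real.pi) • (EuclideanSpace.single (0 : Fin 3) (1 : ℝ)) : EuclideanSpace ℝ (Fin 3)) 1 = y 1 :=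
      by simp
  have h2 : (y + (2 * Real.pi) • (EuclideanSpace.single (0 : Fin 3) (1 : ℝ)) : EuclideanSpace ℝ (Fin 3)) 2 = y 2 :=
      by simp
  have hu : Real.cos (y 0 + 2 * Real.pi + y 2) = Real.cos (y 0 + y 2) := by
    rw [show y 0 + 2 * Real.pi + y 2 = (y 0 + y 2) + 2 * Real.pi by ring, Real.cos_add_two_pi]
  ext i
  fin_cases i
  · simp [triField_apply_zero, h0, h2, hu]
  · simp [triField_apply_one, h1, h2]
  · simp [triField_apply_two, h0, h1, h2, hu]

/-- **The no-source-gauge clause (hng) holds for the three-wave profile**, even without its slope hypotheses: no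
`C²` stream function of the horizontal vorticity of `v` has a source depending on `t` only. [folklore] -/
theorem noSourceGauge_triProfile (ψ : ℝ → EuclideanSpace ℝ (Fin 3) → ℝ) (src : ℝ → ℝ)
    (hψ : ContDiffOn ℝ 2 (uncurry ψ) (Iio (0 : ℝ) ×ˢ univ))
    (hstr : ∀ t < 0, ∀ y, curl (triProfile t) y 0 = fderiv ℝ (ψ t) y (EuclideanSpace.single (1 : Fin 3) (1 : ℝ)) ∧
      curl (triProfile t) y 1 = -fderiv ℝ (ψ t) y (EuclideanSpace.single (0 : Fin 3) (1 : ℝ))) :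
    ∃ t < 0, ∃ x, deriv (fun τ => ψ τ x) t + fderiv ℝ (ψ t) x (triProfile t x) - (Δ (ψ t)) x ≠ src t := by
  by_contra hcon
  push Not at hcon
  -- the two comparison points `P = (π/2) e₀`, `Q = P + 2π e₀`
  set P : EuclideanSpace ℝ (Fin 3) := (Real.pi / 2) • (EuclideanSpace.single (0 : Fin 3) (1 : ℝ)) with hP
  set a : EuclideanSpace ℝ (Fin 3) := (2 * Real.pi) • (EuclideanSpace.single (0 : Fin 3) (1 : ℝ)) with ha
  have hQ : P + a = (Real.pi / 2 + 2 * Real.pi) • (EuclideanSpace.single (0 : Fin 3) (1 : ℝ)) := by rw [hP, ha, ←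
      add_smul]
  have hPQ : (P + a) 2 = P 2 := by simp [hP, ha]
  -- (1) time derivatives: the gauge part `h(τ) = ψ τ P − ψ₀ τ P` is the same at `Q` (same height)
  have hψP : DifferentiableAt ℝ (fun τ : ℝ => ψ τ P) (-1) := by
    have hopen : IsOpen (Iio (0 : ℝ) ×ˢ (univ : Set (EuclideanSpace ℝ (Fin 3)))) := isOpen_Iio.prod isOpen_univ
    have h1 : DifferentiableAt ℝ (uncurry ψ) ((-1 : ℝ), P) :=
      (hψ.differentiableOn (by norm_num)).differentiableAt (hopen.mem_nhds ⟨by norm_num, trivial⟩)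
    have h2 : DifferentiableAt ℝ (fun τ : ℝ => ((τ, P) : ℝ × EuclideanSpace ℝ (Fin 3))) (-1) :=
      differentiableAt_id.prodMk (differentiableAt_const P)
    exact h1.comp (-1) h2
  have hh : DifferentiableAt ℝ (fun τ : ℝ => ψ τ P - 2 * triProfile τ P 2) (-1) :=
    hψP.sub (hasDerivAt_two_mul_triProfile_two_axisPoint (Real.pi / 2)).differentiableAt
  have dP : 2 * (Real.pi / 2) * Real.sin (Real.pi / 2) - 2 * Real.cos (Real.pi / 2) = Real.pi := by
    rw [Real.sin_pi_div_two, Real.cos_pi_div_two]; ring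
  have dQ : 2 * (Real.pi / 2 + 2 * Real.pi) * Real.sin (Real.pi / 2 + 2 * Real.pi) -
      2 * Real.cos (Real.pi / 2 + 2 * Real.pi) = 5 * Real.pi := by
    rw [Real.sin_add_two_pi, Real.cos_add_two_pi, Real.sin_pi_div_two, Real.cos_pi_div_two]; ring
  have eP : deriv (fun τ => ψ τ P) (-1) = Real.pi + deriv (fun τ : ℝ => ψ τ P - 2 * triProfile τ P 2) (-1) := by
    have hfun : (fun τ => ψ τ P) = fun τ => 2 * triProfile τ P 2 + (ψ τ P - 2 * triProfile τ P 2) := by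
      funext τ
      ring
    rw [hfun, ← dP]
    exact ((hasDerivAt_two_mul_triProfile_two_axisPoint (Real.pi / 2)).add hh.hasDerivAt).deriv
  have eQ : deriv (fun τ => ψ τ (P + a)) (-1) =
      5 * Real.pi + deriv (fun τ : ℝ => ψ τ P - 2 * triProfile τ P 2) (-1) := by
    have hev : (fun τ => ψ τ (P + a)) =ᶠ[𝓝 (-1 : ℝ)]
        fun τ => 2 * triProfile τ (P + a) 2 + (ψ τ P - 2 * triProfile τ P 2) := by
      filter_upwards [Iio_mem_nhds (show (-1 : ℝ) < 0 by norm_num)] with τ hτ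
      have := stream_sub_two_mul_triProfile_two_dependsOnHeight hψ hstr hτ hPQ
      linarith
    rw [hev.deriv_eq, hQ, ← dQ]
    exact ((hasDerivAt_two_mul_triProfile_two_axisPoint (Real.pi / 2 + 2 * Real.pi)).add hh.hasDerivAt).deriv
  -- (2) `ψ(−1, ·)` is `2π e₀`-periodic
  have hinv : (fun y => ψ (-1) (y + a)) = ψ (-1) := by
    funext y
    have hy : (y + a) 2 = y 2 := by simp [ha]
    have hd := stream_sub_two_mul_triProfile_two_dependsOnHeight hψ hstr (show (-1 : ℝ) < 0 by norm_num) hy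
    have hper : triProfile (-1) (y + a) 2 = triProfile (-1) y 2 := by
      rw [triProfile_neg_one, ha, triField_add_two_pi_single_zero]
    linarith
  have eL : (Δ (ψ (-1))) (P + a) = (Δ (ψ (-1))) P := by
    rw [← laplacian_comp_add_const (ψ (-1)) a P, hinv]
  have eA : fderiv ℝ (ψ (-1)) (P + a) (triProfile (-1) (P + a)) = fderiv ℝ (ψ (-1)) P (triProfile (-1) P) := by
    rw [← fderiv_comp_add_right a, hinv, triProfile_neg_one, ha, triField_add_two_pi_single_zero]
  -- (3) the two sources differ by `4π`
  have h1 := hcon (-1) (by norm_num) P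
  have h2 := hcon (-1) (by norm_num) (P + a)
  rw [eP] at h1
  rw [eQ, eL, eA] at h2
  linarith [Real.pi_pos]

end Summit.NavierStokesRegularity.NavierStokesRegularity.Theorems.PoloidalWindowRigidity.Negative

end
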